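import Mathlib
import Summits.PneNP.PneNP.Theorems.Sd2BlSpotPackage
import Summits.PneNP.PneNP.Theorems.Sd2BlRemainder
import Summits.PneNP.PneNP.Theorems.SfmBlAssembly
import Summits.PneNP.PneNP.Theorems.SfmBlCutFromTrace

/-!
# The parametric pipeline theorem of the sign-degree-2 engine: from a greedy signing to a LEG BOUND
# (cell pnp-ideate, ROUND-18 item K1'' `SignDeg2Signing.SignDeg2SigningFP`, stage S2 — the twin of
# `SfmBl.cutCertified_of_pipeline` with `ℓ` legs per output and symbolic constants)

FRONTIER (range avoidance for sign-degree-≤2 local maps at linear stretch; restricted-model algorithmic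
rung); nothing here bears on P vs NP.

`legBound_of_pipeline`: for ANY finite leg system (`src : E → α`, `dst : E → β`, `out : E → Fin m`) with
`≤ ℓ` legs per output (`ℓ ≥ 3`), a size exponent `t ≥ 1` with `(T1) 28800·ℓ³·s·(s+1) ≤ 2^t` (`s = 2t`),
leg-degrees `≤ L = 4^t`, `1 ≤ N ≤ 8n + 2ℓm/L` pieces, stretch `48·R·n ≤ m` (`R = 2400·ℓ²·s·(s+1)·2^t`),
parameters `j, b, t₀` with `N ≤ 2^b`, `2·2^{j+2} + 2b ≤ 10(t₀+1)`, `20N ≤ 2^{2^{j+1}}`, ANY spot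
decomposition `(r, p, V₁, V₂)` with the four clauses (sparse remainder at threshold `γ_R = 4ℓ√(34ℓLs)` on
connected pairs of size `≤ t₀`; spot sides; density `γ_R√(|V₁||V₂|) < #E_s`; cover `|V₁|+|V₂| ≤ 2#E_s`),
part matrices `MpT`, spot families `𝒲 s` / `bad s T` by MEMBERSHIP (bad threshold `γ_b = √(34ℓLs)`), the
explicit potential `F T = tr((fromBlocks 0 (MpT T none) ⋯)^{2^{j+2}})/A₁ + ê(T)/A₃`
(`A₁ = 10(N·R^{2^{j+2}} + 1)`, `A₃ = (6/5)(Q₀+1)`, `Q₀ = Σ_s 4(|V₁ s|+|V₂ s|)·L⁻¹⁰`), and a GREEDY PATH `y`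
for `F`: the unsigned leg functional satisfies `Σ_e χ(y_{out e})·σ′(src e)·φ′(dst e) < m` for all real `±1`
vectors `σ′, φ′` on the pieces — the hypothesis `hB` (with `B = m < 2m = τ·m`) of the K1'' interface
`SignDeg2Legs.sigCertified_of_legBound`.  Budget: remainder `≤ m/4`, spots `≤ m/2` (density factor `4ℓ`,
`#E ≤ ℓm`), bad part `< 1.2 + m/100`, and `m ≥ 48R > 5`.
-/

set_option linter.dupNamespace false -- `Summit.PneNP.PneNP.…`: summit = sub-problem name (D-0017 single-conjunct layout)

namespace Summit.PneNP.PneNP.Theorems.Sd2Bl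

open Matrix Finset BigOperators
open Summit.PneNP.PneNP.Theorems.CandCutNorm Summit.PneNP.PneNP.Theorems.SfmBl

/-- In any leg system with `≤ ℓ` legs per output, each output owns at most `ℓ` legs of any part. -/
theorem card_part_out_le {E κ : Type*} [Fintype E] [DecidableEq κ] {m : ℕ} (out : E → Fin m)
    (p : E → κ) (c : κ) {ℓ : ℕ} (hout : ∀ j : Fin m, (Finset.univ.filter fun e => out e = j).card ≤ ℓ)
    (j : Fin m) :
    ((Finset.univ : Finset {e : E // p e = c}).filter (fun e => out e.1 = j)).card ≤ ℓ := by
  classical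
  rw [card_part_eq p c (fun e => out e = j)]
  exact le_trans (Finset.card_le_card fun e he => by
    simp only [Finset.mem_filter, Finset.mem_univ, true_and] at he ⊢; exact he.1) (hout j)

/-- The total number of legs is at most `ℓ·m`. -/
theorem card_legs_le {E : Type*} [Fintype E] {m : ℕ} (out : E → Fin m) {ℓ : ℕ}
    (hout : ∀ j : Fin m, (Finset.univ.filter fun e => out e = j).card ≤ ℓ) :
    Fintype.card E ≤ ℓ * m := by
  classical
  have h := Finset.card_eq_sum_card_fiberwise (f := out) (s := (Finset.univ : Finset E))
    (t := Finset.univ) (fun e _ => Finset.mem_univ _)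
  rw [Finset.card_univ] at h
  rw [h]
  calc ∑ j : Fin m, (Finset.univ.filter fun e => out e = j).card ≤ ∑ _j : Fin m, ℓ :=
        Finset.sum_le_sum fun j _ => hout j
    _ = ℓ * m := by rw [Finset.sum_const, Finset.card_univ, Fintype.card_fin, smul_eq_mul, mul_comm]

/-- **THE PARAMETRIC PIPELINE THEOREM OF THE SIGN-DEGREE-2 ENGINE** (see the module docstring). -/
theorem legBound_of_pipeline {n m : ℕ} {α β E : Type} [Fintype α] [Fintype β] [DecidableEq α]
    [DecidableEq β] [Fintype E] [DecidableEq E] (src : E → α) (dst : E → β) (out : E → Fin m)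
    {ℓ : ℕ} (hℓ : 3 ≤ ℓ) (hout : ∀ j : Fin m, (Finset.univ.filter fun e => out e = j).card ≤ ℓ)
    (t : ℕ) (ht : 1 ≤ t) (hT1 : 28800 * ℓ ^ 3 * (2 * t) * (2 * t + 1) ≤ 2 ^ t)
    (hn : 0 < n) (hm : 48 * (2400 * ℓ ^ 2 * (2 * t) * (2 * t + 1) * 2 ^ t) * n ≤ m)
    (hdeg₁ : ∀ i, (Finset.univ.filter fun e => src e = i).card ≤ 2 ^ (2 * t))
    (hdeg₂ : ∀ k, (Finset.univ.filter fun e => dst e = k).card ≤ 2 ^ (2 * t))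
    (hN1 : 1 ≤ Fintype.card α + Fintype.card β)
    (hN : ((Fintype.card α : ℝ) + Fintype.card β) ≤ 8 * n + 2 * ℓ * m / (2 : ℝ) ^ (2 * t))
    -- the exponent and threshold parameters
    (j b t₀ : ℕ) (hNb : ((Fintype.card α : ℝ) + Fintype.card β) ≤ 2 ^ b)
    (ht₀ : 2 * 2 ^ (j + 2) + 2 * b ≤ 10 * (t₀ + 1))
    (hj : 20 * ((Fintype.card α : ℝ) + Fintype.card β) ≤ 2 ^ (2 ^ (j + 1)))
    -- the spot decomposition
    (r : ℕ) (p : E → Option (Fin r)) (V₁ : Fin r → Finset α) (V₂ : Fin r → Finset β)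
    (hsp : ∀ (W₁ : Finset α) (W₂ : Finset β),
      ((bipGraph (fun i k => ∃ e, src e = i ∧ dst e = k)).induce
          {x | Sum.elim (fun i => i ∈ W₁) (fun j => j ∈ W₂) x}).Connected →
      W₁.card + W₂.card ≤ t₀ →
      ((Finset.univ.filter fun e => p e = none ∧ src e ∈ W₁ ∧ dst e ∈ W₂).card : ℝ)
        ≤ (4 * ℓ * Real.sqrt (34 * ℓ * (2 : ℝ) ^ (2 * t) * (2 * t : ℕ)))
          * Real.sqrt ((W₁.card : ℝ) * (W₂.card : ℝ)))
    (hsides : ∀ s e, p e = some s → src e ∈ V₁ s ∧ dst e ∈ V₂ s)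
    (hdense : ∀ s, (4 * ℓ * Real.sqrt (34 * ℓ * (2 : ℝ) ^ (2 * t) * (2 * t : ℕ)))
      * Real.sqrt (((V₁ s).card : ℝ) * ((V₂ s).card : ℝ))
      < ((Finset.univ.filter fun e => p e = some s).card : ℝ))
    (hcov : ∀ s, (V₁ s).card + (V₂ s).card ≤ 2 * (Finset.univ.filter fun e => p e = some s).card)
    -- the part matrices
    (MpT : (Fin m → Bool) → Option (Fin r) → Matrix α β ℝ)
    (hMpT : ∀ T c i k, MpT T c i k = ∑ e ∈ Finset.univ.filter
      (fun e : E => src e = i ∧ dst e = k ∧ p e = c), ((boolSign (T (out e)) : ℤ) : ℝ))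
    -- the spot families, by membership
    (𝒲 : Fin r → Finset (Finset α × Finset β))
    (h𝒲 : ∀ s W, W ∈ 𝒲 s ↔ W.1 ⊆ V₁ s ∧ W.2 ⊆ V₂ s ∧
      IsConnectedPair (fun i k => ∃ e : {e // p e = some s}, src e.1 = i ∧ dst e.1 = k) W.1 W.2)
    (bad : Fin r → (Fin m → Bool) → Finset (Finset α × Finset β))
    (hbad : ∀ s T W, W ∈ bad s T ↔ W ∈ 𝒲 s ∧
      Real.sqrt (34 * ℓ * (2 : ℝ) ^ (2 * t) * (2 * t : ℕ)) * Real.sqrt ((W.1.card : ℝ) * (W.2.card : ℝ))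
        < |∑ i ∈ W.1, ∑ k ∈ W.2, MpT T (some s) i k|)
    -- the explicit potential and a greedy path for it
    (F : (Fin m → Bool) → ℝ)
    (hF : ∀ T, F T =
      ((Matrix.fromBlocks 0 (MpT T none) (MpT T none)ᵀ 0) ^ (2 ^ (j + 2))).trace
          / (10 * (((Fintype.card α : ℝ) + Fintype.card β)
              * (2400 * (ℓ : ℝ) ^ 2 * (2 * t : ℕ) * ((2 * t : ℕ) + 1) * (2 : ℝ) ^ t) ^ (2 ^ (j + 2)) + 1))
        + (∑ s, ∑ W ∈ bad s T, ((Finset.univ.filter fun e : E =>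
              (src e ∈ W.1 ∨ dst e ∈ W.2) ∧ p e = some s).card : ℝ))
          / (6 / 5 * (∑ s, 4 * (((V₁ s).card : ℝ) + (V₂ s).card) * (((2 : ℝ) ^ (2 * t)) ^ 10)⁻¹ + 1)))
    (y : Fin m → Bool)
    (hgreedy : ∀ (k : ℕ) (hk : k < m),
      ∑ T' ∈ Finset.univ.filter (fun T' : Fin m → Bool => ∀ i : Fin m, (i : ℕ) < k + 1 → T' i = y i), F T'
        ≤ ∑ T' ∈ Finset.univ.filter
            (fun T' : Fin m → Bool => (∀ i : Fin m, (i : ℕ) < k → T' i = y i) ∧ T' ⟨k, hk⟩ ≠ y ⟨k, hk⟩),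
            F T') :
    ∀ (σ' : α → ℝ) (φ' : β → ℝ), (∀ i, σ' i = 1 ∨ σ' i = -1) → (∀ k, φ' k = 1 ∨ φ' k = -1) →
      ∑ e : E, ((boolSign (y (out e)) : ℤ) : ℝ) * σ' (src e) * φ' (dst e) < (m : ℝ) := by
  classical
  -- abbreviations
  obtain ⟨L, hLdef⟩ : ∃ L : ℝ, L = (2 : ℝ) ^ (2 * t) := ⟨_, rfl⟩
  obtain ⟨R, hRdef⟩ : ∃ R : ℝ, R = 2400 * (ℓ : ℝ) ^ 2 * (2 * t : ℕ) * ((2 * t : ℕ) + 1) * (2 : ℝ) ^ t :=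
    ⟨_, rfl⟩
  obtain ⟨γb, hγbdef⟩ : ∃ γb : ℝ, γb = Real.sqrt (34 * ℓ * (2 : ℝ) ^ (2 * t) * (2 * t : ℕ)) := ⟨_, rfl⟩
  have hℓ1 : 1 ≤ ℓ := le_trans (by norm_num) hℓ
  have hℓpos : 0 < ℓ := lt_of_lt_of_le (by norm_num) hℓ
  have hℓr : (0 : ℝ) < ℓ := by exact_mod_cast hℓpos
  have hLcast : ((2 ^ (2 * t) : ℕ) : ℝ) = L := by rw [hLdef]; push_cast; ring
  have hL2 : (2 : ℝ) ≤ L := by rw [hLdef]; exact two_le_L ht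
  have hL0 : (0 : ℝ) < L := by linarith
  have hLn : 0 < (2 ^ (2 * t) : ℕ) := by positivity
  have hLn2 : (2 : ℝ) ≤ ((2 ^ (2 * t) : ℕ) : ℝ) := by rw [hLcast]; exact hL2
  have hγb0 : 0 ≤ γb := by rw [hγbdef]; exact Real.sqrt_nonneg _
  have hK : (0 : ℝ) < 4 * ℓ := by positivity
  have hγ'L : 144 * ((2 ^ (2 * t) : ℕ) : ℝ) * Real.log ((2 ^ (2 * t) : ℕ) : ℝ)
      ≤ (Real.sqrt (102 * (2 : ℝ) ^ (2 * t) * (2 * t : ℕ))) ^ 2 := by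
    rw [hLcast, hLdef]; exact gamma'_sq_ge (2 * t)
  have hγγ' : (Real.sqrt (102 * (2 : ℝ) ^ (2 * t) * (2 * t : ℕ))) ^ 2 * ℓ ≤ 3 * γb ^ 2 := by
    rw [hγbdef]; exact gamma'_sq_mul_ell ℓ (2 * t)
  -- the graph
  obtain ⟨Es, hEs⟩ : ∃ Es : α → β → Prop, Es = fun i k => ∃ e, src e = i ∧ dst e = k := ⟨_, rfl⟩
  haveI : DecidableRel (bipGraph Es).Adj := Classical.decRel _
  have hG : ∀ e, (bipGraph Es).Adj (Sum.inl (src e)) (Sum.inr (dst e)) := fun e =>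
    (bipGraph_adj_inl_inr Es _ _).2 (by rw [hEs]; exact ⟨e, rfl, rfl⟩)
  have hGdeg : ∀ x, (bipGraph Es).degree x ≤ 2 ^ (2 * t) := by
    intro x; subst hEs; exact degree_bipGraph_le src dst hdeg₁ hdeg₂ x
  -- part matrices in subtype form
  have hMpT' : ∀ T c i k, MpT T c i k = ∑ e ∈ (Finset.univ : Finset {e // p e = c}).filter
      (fun e => src e.1 = i ∧ dst e.1 = k), ((boolSign (T (out e.1)) : ℤ) : ℝ) := by
    intro T c i k
    rw [hMpT, sum_part_eq₂ p c (fun e => src e = i) (fun e => dst e = k)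
      (fun e => ((boolSign (T (out e)) : ℤ) : ℝ))]
  ------------------------------------------------------------------
  -- the sparse remainder
  ------------------------------------------------------------------
  have hexp : 2 ^ (j + 2) = 2 * 2 ^ (j + 1) := by rw [pow_succ]; ring
  have hkb : 2 * (2 * 2 ^ (j + 1)) + 2 * b ≤ 10 * (t₀ + 1) := by rw [← hexp]; exact ht₀
  obtain ⟨hA₁r, hsum₁, hbudR⟩ := remainder_package_ell
    (fun e : {e // p e = none} => src e.1) (fun e => dst e.1) (fun e => out e.1) hℓ
    (fun j' => card_part_out_le out p none hout j') t ht hT1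
    (fun i => by
      rw [card_part_eq p none (fun e => src e = i)]
      exact le_trans (Finset.card_le_card fun e he => by
        simp only [Finset.mem_filter, Finset.mem_univ, true_and] at he ⊢; exact he.1) (hdeg₁ i))
    (fun k => by
      rw [card_part_eq p none (fun e => dst e = k)]
      exact le_trans (Finset.card_le_card fun e he => by
        simp only [Finset.mem_filter, Finset.mem_univ, true_and] at he ⊢; exact he.1) (hdeg₂ k))
    (bipGraph Es) (fun e => hG e.1) hGdeg hm hN1 hN (2 ^ (j + 1)) b t₀ hNb hkb hj
    (fun W₁ W₂ hconn hsize => by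
      rw [card_part_eq₂ p none (fun e => src e ∈ W₁) (fun e => dst e ∈ W₂)]
      rw [hEs] at hconn
      exact hsp W₁ W₂ hconn hsize)
    (fun T => MpT T none) (fun T i k => hMpT' T none i k)
  rw [← hexp] at hA₁r hsum₁
  rw [← hRdef] at hA₁r hsum₁ hbudR
  ------------------------------------------------------------------
  -- the spots
  ------------------------------------------------------------------
  have hpack := fun s : Fin r => spot_package_explicit_ell
    (fun e : {e // p e = some s} => src e.1) (fun e => dst e.1) (fun e => out e.1) (V₁ s) (V₂ s)
    (fun e => hsides s e.1 e.2) hℓpos (fun j' => card_part_out_le out p (some s) hout j') hLn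
    (fun i => by
      rw [card_part_eq p (some s) (fun e => src e = i)]
      exact le_trans (Finset.card_le_card fun e he => by
        simp only [Finset.mem_filter, Finset.mem_univ, true_and] at he ⊢; exact he.1) (hdeg₁ i))
    (fun k => by
      rw [card_part_eq p (some s) (fun e => dst e = k)]
      exact le_trans (Finset.card_le_card fun e he => by
        simp only [Finset.mem_filter, Finset.mem_univ, true_and] at he ⊢; exact he.1) (hdeg₂ k))
    hLn2 hγb0 hγ'L hγγ' hK
    (by
      rw [card_part_univ p (some s), hγbdef]
      have := hdense s
      calc 4 * (ℓ : ℝ) * Real.sqrt (34 * ℓ * (2 : ℝ) ^ (2 * t) * (2 * t : ℕ))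
            * Real.sqrt (((V₁ s).card : ℝ) * ((V₂ s).card : ℝ))
          = (4 * ℓ * Real.sqrt (34 * ℓ * (2 : ℝ) ^ (2 * t) * (2 * t : ℕ)))
            * Real.sqrt (((V₁ s).card : ℝ) * ((V₂ s).card : ℝ)) := by ring
        _ < _ := this)
    (fun T => MpT T (some s)) (fun T i k => hMpT' T (some s) i k) (𝒲 s) (h𝒲 s) (bad s)
    (fun T W => by rw [hbad s T W, hγbdef])
  -- the explicit `ê` in all-legs form
  have hmeet : ∀ (s : Fin r) (W : Finset α × Finset β),
      (((Finset.univ : Finset {e // p e = some s}).filter fun e => src e.1 ∈ W.1 ∨ dst e.1 ∈ W.2).card : ℝ)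
        = ((Finset.univ.filter fun e : E => (src e ∈ W.1 ∨ dst e ∈ W.2) ∧ p e = some s).card : ℝ) := by
    intro s W
    rw [card_part_eq p (some s) (fun e => src e ∈ W.1 ∨ dst e ∈ W.2)]
  obtain ⟨Lc, hLc⟩ : ∃ Lc : ℝ, Lc = (((2 : ℝ) ^ (2 * t)) ^ 10)⁻¹ := ⟨_, rfl⟩
  have hLc' : ((((2 ^ (2 * t) : ℕ) : ℝ)) ^ 10)⁻¹ = Lc := by rw [hLc, hLcast, hLdef]
  have hL10 : (0 : ℝ) ≤ Lc := by rw [hLc]; positivity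
  ------------------------------------------------------------------
  -- the potential
  ------------------------------------------------------------------
  obtain ⟨Q₀, hQ₀⟩ : ∃ Q₀ : ℝ,
      Q₀ = ∑ s : Fin r, 4 * (((V₁ s).card : ℝ) + (V₂ s).card) * Lc := ⟨_, rfl⟩
  have hQ₀0 : 0 ≤ Q₀ := by
    rw [hQ₀]
    refine Finset.sum_nonneg fun s _ => mul_nonneg (mul_nonneg (by norm_num) ?_) hL10
    exact add_nonneg (Nat.cast_nonneg _) (Nat.cast_nonneg _)
  obtain ⟨A₁, hA₁def⟩ : ∃ A₁ : ℝ,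
      A₁ = 10 * (((Fintype.card α : ℝ) + Fintype.card β) * R ^ (2 ^ (j + 2)) + 1) := ⟨_, rfl⟩
  have hR0 : 0 ≤ R := by rw [hRdef]; positivity
  have hA₁ : 0 < A₁ := by
    rw [hA₁def]
    have : (0 : ℝ) ≤ ((Fintype.card α : ℝ) + Fintype.card β) * R ^ (2 ^ (j + 2)) :=
      mul_nonneg (add_nonneg (Nat.cast_nonneg _) (Nat.cast_nonneg _)) (pow_nonneg hR0 _)
    linarith only [this]
  let trR : (Fin m → Bool) → ℝ := fun T =>
    ((Matrix.fromBlocks 0 (MpT T none) (MpT T none)ᵀ 0) ^ (2 ^ (j + 2))).trace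
  let hat : (Fin m → Bool) → ℝ := fun T => ∑ s, ∑ W ∈ bad s T,
    (((Finset.univ : Finset {e // p e = some s}).filter fun e => src e.1 ∈ W.1 ∨ dst e.1 ∈ W.2).card : ℝ)
  have htr0 : ∀ T, 0 ≤ trR T := fun T => by
    show 0 ≤ ((Matrix.fromBlocks 0 (MpT T none) (MpT T none)ᵀ 0) ^ (2 ^ (j + 2))).trace
    rw [hexp]; exact trace_fromBlocks_pow_two_mul_nonneg _ _
  have hhat0 : ∀ T, 0 ≤ hat T := fun T =>
    Finset.sum_nonneg fun s _ => Finset.sum_nonneg fun W _ => Nat.cast_nonneg _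
  have hsum₂ : ∑ T, hat T ≤ 2 ^ m * Q₀ := by
    show ∑ T, ∑ s, ∑ W ∈ bad s T, _ ≤ 2 ^ m * Q₀
    rw [Finset.sum_comm, hQ₀, Finset.mul_sum]
    refine Finset.sum_le_sum fun s _ => ?_
    have := (hpack s).2
    rw [hLc'] at this
    exact this
  have hsum₁' : ∑ T, trR T ≤ 2 ^ m * (A₁ / 10) := by rw [hA₁def]; exact hsum₁
  have hF' : ∀ T, F T = trR T / A₁ + hat T / (6 / 5 * (Q₀ + 1)) := by
    intro T
    rw [hF T, hA₁def, hQ₀, hLc, hRdef]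
    simp only [trR, hat, hmeet]
  obtain ⟨htrA, hhatA⟩ :=
    greedy_two_part_bounds trR hat F htr0 hhat0 hA₁ hQ₀0 hF' hsum₁' hsum₂ y hgreedy
  ------------------------------------------------------------------
  -- per-part cut bounds for `y`
  ------------------------------------------------------------------
  have hrr : (0 : ℝ) ≤ Real.sqrt 2 * R := by positivity
  have htrace : ((Matrix.fromBlocks 0 (MpT y none) (MpT y none)ᵀ 0) ^ (2 ^ (j + 2))).trace
      ≤ (Real.sqrt 2 * R) ^ (2 ^ (j + 2)) := by
    have h1 : trR y < A₁ := htrA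
    rw [hA₁def] at h1
    exact le_trans h1.le hA₁r
  have hRem : ∀ (σ : α → ℝ) (φ : β → ℝ), (∀ i, σ i = 1 ∨ σ i = -1) → (∀ k, φ k = 1 ∨ φ k = -1) →
      σ ⬝ᵥ (MpT y none *ᵥ φ) ≤ ((Fintype.card α : ℝ) + Fintype.card β) * (Real.sqrt 2 * R) / 2 := by
    intro σ φ hσ hφ
    exact (le_abs_self _).trans (abs_cut_le_of_trace_pow_le (MpT y none) σ φ hσ hφ j hrr htrace)
  let X : Option (Fin r) → ℝ := fun c =>
    match c with
    | none => ((Fintype.card α : ℝ) + Fintype.card β) * (Real.sqrt 2 * R) / 2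
    | some s => 2 * (Fintype.card {e // p e = some s} : ℝ) / (4 * ℓ) + ∑ W ∈ bad s y,
        (((Finset.univ : Finset {e // p e = some s}).filter fun e => src e.1 ∈ W.1 ∨ dst e.1 ∈ W.2).card : ℝ)
  have hX : ∀ c (σ : α → ℝ) (φ : β → ℝ), (∀ i, σ i = 1 ∨ σ i = -1) → (∀ k, φ k = 1 ∨ φ k = -1) →
      σ ⬝ᵥ (MpT y c *ᵥ φ) ≤ X c := by
    intro c σ φ hσ hφ
    cases c with
    | none => exact hRem σ φ hσ hφ
    | some s => exact ((hpack s).1 y σ φ hσ hφ).le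
  ------------------------------------------------------------------
  -- the budget
  ------------------------------------------------------------------
  have hR1 : (1 : ℝ) ≤ R := by
    rw [hRdef]
    have hℓ' : (1 : ℝ) ≤ (ℓ : ℝ) ^ 2 := one_le_pow₀ (by exact_mod_cast hℓ1)
    have hs1 : (1 : ℝ) ≤ ((2 * t : ℕ) : ℝ) := by exact_mod_cast (by omega : 1 ≤ 2 * t)
    have hs2 : (1 : ℝ) ≤ ((2 * t : ℕ) : ℝ) + 1 := by linarith
    have h2t : (1 : ℝ) ≤ (2 : ℝ) ^ t := one_le_pow₀ (by norm_num)
    have a1 : (1 : ℝ) ≤ 2400 * (ℓ : ℝ) ^ 2 := one_le_mul_of_one_le_of_one_le (by norm_num) hℓ'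
    have a2 := one_le_mul_of_one_le_of_one_le a1 hs1
    have a3 := one_le_mul_of_one_le_of_one_le a2 hs2
    exact one_le_mul_of_one_le_of_one_le a3 h2t
  have hm48 : (48 : ℝ) ≤ m := by
    have h1 : ((48 * (2400 * ℓ ^ 2 * (2 * t) * (2 * t + 1) * 2 ^ t) * n : ℕ) : ℝ) ≤ m := by
      exact_mod_cast hm
    have h2 : (1 : ℝ) ≤ n := by exact_mod_cast hn
    have h3 : (48 : ℝ) * R * n ≤ m := by rw [hRdef]; push_cast at h1 ⊢; linarith
    have h4 : (1 : ℝ) ≤ R * n := one_le_mul_of_one_le_of_one_le hR1 h2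
    linarith
  have hElegs : (Fintype.card E : ℝ) ≤ ℓ * m := by exact_mod_cast card_legs_le out hout
  have hspots : ∑ s : Fin r, (Fintype.card {e // p e = some s} : ℝ) ≤ ℓ * m := by
    have h1 := sum_card_parts_le p
    have h2 : ∀ s : Fin r, (Fintype.card {e // p e = some s} : ℝ)
        = ((Finset.univ.filter fun e => p e = some s).card : ℝ) := fun s => by rw [card_part_univ]
    simp only [h2]
    have h3 : ((∑ s : Fin r, (Finset.univ.filter fun e => p e = some s).card : ℕ) : ℝ)
        ≤ (Fintype.card E : ℝ) := by exact_mod_cast h1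
    push_cast at h3
    linarith
  have h4896 := cond4896_of_T1 ℓ t hℓ1 hT1
  have h960 : 960 * (ℓ : ℝ) ≤ L ^ 10 := by
    have hs1 : (1 : ℝ) ≤ ((2 * t : ℕ) : ℝ) := by exact_mod_cast (by omega : 1 ≤ 2 * t)
    rw [hLdef]; exact cond960 (Nat.cast_nonneg ℓ) hs1 (by linarith [two_le_L ht]) h4896
  have hQ₀le : Q₀ ≤ (m : ℝ) / 120 := by
    refine Q0_budget hL0 h960 ?_
    rw [hQ₀, ← Finset.sum_mul, hLc, ← hLdef]
    refine mul_le_mul_of_nonneg_right ?_ (by positivity)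
    have h1 : ∀ s : Fin r, 4 * (((V₁ s).card : ℝ) + (V₂ s).card)
        ≤ 8 * (Fintype.card {e // p e = some s} : ℝ) := by
      intro s
      have := hcov s
      rw [card_part_univ]
      have h' : (((V₁ s).card : ℝ) + (V₂ s).card) ≤ 2 * ((Finset.univ.filter fun e => p e = some s).card : ℝ) := by
        exact_mod_cast this
      linarith only [h']
    calc ∑ s, 4 * (((V₁ s).card : ℝ) + (V₂ s).card) ≤ ∑ s, 8 * (Fintype.card {e // p e = some s} : ℝ) :=
          Finset.sum_le_sum fun s _ => h1 s
      _ = 8 * ∑ s, (Fintype.card {e // p e = some s} : ℝ) := by rw [Finset.mul_sum]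
      _ ≤ 8 * ℓ * m := by linarith [hspots]
  have hbud : ∑ c, X c < m := by
    rw [Fintype.sum_option]
    simp only [X]
    rw [Finset.sum_add_distrib]
    have h1 : ∑ s : Fin r, 2 * (Fintype.card {e // p e = some s} : ℝ) / (4 * ℓ) ≤ (m : ℝ) / 2 := by
      rw [← Finset.sum_div, ← Finset.mul_sum, div_le_div_iff₀ hK (by norm_num)]
      linarith [hspots]
    have h2 : ∑ s : Fin r, ∑ W ∈ bad s y,
        (((Finset.univ : Finset {e // p e = some s}).filter fun e => src e.1 ∈ W.1 ∨ dst e.1 ∈ W.2).card : ℝ)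
        < 6 / 5 * (Q₀ + 1) := hhatA
    linarith only [h1, h2, hbudR, hQ₀le, hm48]
  ------------------------------------------------------------------
  -- from the part bounds to the leg functional
  ------------------------------------------------------------------
  intro σ' φ' hσ' hφ'
  obtain ⟨M, hM⟩ : ∃ M : Matrix α β ℝ, M = fun i k => ∑ e ∈ Finset.univ.filter
      (fun e : E => src e = i ∧ dst e = k), ((boolSign (y (out e)) : ℤ) : ℝ) := ⟨_, rfl⟩
  have hM' : ∀ i k, M i k = ∑ e ∈ Finset.univ.filter (fun e : E => src e = i ∧ dst e = k),
      ((boolSign (y (out e)) : ℤ) : ℝ) := fun i k => by rw [hM]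
  have h := bilin_le_sum_of_parts src dst (fun e => ((boolSign (y (out e)) : ℤ) : ℝ)) p M hM'
    (MpT y) (fun c i k => by rw [hMpT]) σ' φ' X (fun c => hX c σ' φ' hσ' hφ')
  rw [bilin_eq_sum_legs src dst _ M hM' σ' φ'] at h
  exact lt_of_le_of_lt h hbud

end Summit.PneNP.PneNP.Theorems.Sd2Bl
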